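import Mathlib
import HarnessLib
import Summits.HubbardSuperconductivity.HubbardSuperconductivity.Theorems.KLProgrammeKLRegimeEngineTwoLegStepV17F2ClosersGridBinderCThr

/-!
# Route `KLProgramme` — ENGINE child gen 8 (stmt-HubbardSuperconductivity-20437 `KLRegimeEngineV17F2`), stub (e) under the (T′-B) text (token #27
# `TwoLegGridMomentsAtC`): the GENERIC-THRESHOLD (e) closer made GEOMETRY-GENERIC (so it applies at the rev-13 tokens `(klEngGeo11, klEngQ9c P R, klC4aJetC2)`)
# (cell gate-hubbard-kl, seat p1b g14 — 20437 registrant lineage; sequel of r2d-p1 g9's p575503 `…ClosersGridBinderCThr`, whose (e) lane is unseated)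

WHY.  The (e) closer of record p575503 `stub_twoLeg_step_of_gridBinderC_dualRows_raise_thr` is keyed at the geometry token `klEngGeo8` (history, engine slot, grid
binder `hGs`, two-volume rows), and r2d-p1 g9's hand-over listed «v2-day: ONE-LINE application in p1b's §C».  Since then the v2 image moved its `G` token three times
(rev 9 `klEngGeo9 = klEngGeo8.addShellLog 2⁵²`, rev 11 `klEngGeo10 = klEngGeo9.raiseCF klE5CFM`, rev 13 `klEngGeo11 = klEngGeo10.addTwoShell klTSA`; standing
image-elect c6c418fe3121960f), so the one-line application no longer type-checks: the (e) TEXT now reads `HistP klPredsV17F2 L M klEngGeo11 …`,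
`EngineBoundsAtV17F2 L M klEngGeo11 …`, `histV17F2 L₁ M₁ klEngGeo11 …` inside `hGs`.  The proof of p575503 is `G`-generic in every step (it reads `G` only through
`cJ ≤ G.S`); only its statement pins `klEngGeo8`.  This file restores the one-line application at ANY geometry token:

* **`stub_twoLeg_step_of_gridBinderC_dualRows_raise_thr_G`** — p575503 with `G` a binder and `hGS : ∀ k, cJ k ≤ G.S k` (proof byte-identical otherwise);
* the instance at the rev-13 tokens is the ONE LINE `stub_twoLeg_step_of_gridBinderC_dualRows_raise_thr_G klEngGeo11 P R c (klEngQ9c P R) (isRaiseOf_klEngQ9c P R)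
  klC4aJetC2 (fun k => klC4aJetC2_le_klEngGeo8_S k) …` (`klEngGeo11.S = klEngGeo8.S` definitionally): the (e) TEXT of the image modulo the two-volume rows
  (stmt-…-20440's `hd/hdCL/hDsum/hDc/hdualSp/hdualCut`) and the three threshold rows `hUm/hUq/hrow` (DefsU12's `min_le` components), doors `klEngC₃6 / klEngU₀10 / klEngL₄`
  (the frozen `klEngC₃7/klEngU₀12` add one `.trans` each) — farm-rehearsed in the registrant's rev-13 rehearsal file (HOME/prover-p1b/g14/, not a tree object).

Proofs only; no definitions; nothing about the model is asserted; nothing asserts any stub of 20437, K3 or superconductivity.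
References: BGM 2006 §2.4 (2.23), (2.36), §3 [cite: BenfattoGiulianiMastropietro2006].
-/

noncomputable section

namespace Summit.HubbardSuperconductivity.HubbardSuperconductivity.Theorems.EngineV8

set_option linter.dupNamespace false -- summit = problem name (single-conjunct summit), D-0017

open Real Finset Complex Literature.MathematicalPhysics.QuantumLattice Literature.Probability.LatticeModels GrassmannAlgebra
open Literature.MathematicalPhysics.QuantumLattice.FermiRG Literature.MathematicalPhysics.QuantumLattice.BandSectorCounting
open Summit.HubbardSuperconductivity.HubbardSuperconductivity.Theorems.KLProgrammeLegKernels
open Summit.HubbardSuperconductivity.HubbardSuperconductivity.Theorems.DispersionFlow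
open Summit.HubbardSuperconductivity.HubbardSuperconductivity.Theorems.PerturbedFermiCurve
open Summit.HubbardSuperconductivity.HubbardSuperconductivity.Theorems.KLRegimeSplit
open Summit.HubbardSuperconductivity.HubbardSuperconductivity.Theorems.TwoPointAssembly
open Summit.HubbardSuperconductivity.HubbardSuperconductivity.Theorems.TwoVolumeDefect
open Summit.HubbardSuperconductivity.HubbardSuperconductivity.Theorems.TwoLegFourier

/-! ## §1 The (e) closer, geometry-generic -/

/-- **STUB (e) UNDER (T′-B), GENERIC-THRESHOLD FORM, MODULO THE VL ROWS — GEOMETRY-GENERIC**: r2d-p1's `stub_twoLeg_step_of_gridBinderC_dualRows_raise_thr`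
(p575503) with the geometry package a BINDER `G` read only through its jet table (`hGS : cJ ≤ G.S`) — the history `HistP … G …`, the engine slot, the (R59w) grid binder
`hGs` and the two-volume rows `hdualSp`/`hdualCut` are keyed at the same `G`; `Q` any raise of `klEngQ7 P R` as before.  Proof = p575503's, whose every step was already
`G`-generic (`spLeg_/cutLeg_allScales_of_gridMoments_V17F2_geometric4`, `twoLegStepV17F2_of_jets_sepTubeGradient_nestedLegs_pkg`). -/
theorem stub_twoLeg_step_of_gridBinderC_dualRows_raise_thr_G (G : GeoConsts) (P : SplitConsts) (R : RenConsts) (c : ℝ) (Q : EngConsts)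
    (hQ : (klEngQ7 P R).IsRaiseOf Q) (cJ : ℕ → ℝ) (hGS : ∀ k, cJ k ≤ G.S k) (hP : P.WF) (hR : R.WF2) (hc : 0 < c)
    (hc3 : c ≤ klEngC₃6 P R) (μ : ℝ) (hμ : μ ∈ klWindowC) (U : ℝ) (hU : 0 < U) (hUle : U ≤ klEngU₀10 P R c) (β : ℝ) (hβ : klBetaMin ≤ β)
    (hβc : β ≤ Real.exp (c / U ^ 2)) (L M : ℕ) [NeZero L] [NeZero M] (hL : klEngL₄ P R β U ≤ L) (hM : klEngM₃ β U L ≤ M)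
    (n : ℕ) (hn1 : 1 ≤ n) (hn : n ≤ nScales β + 1) (hreg : IsKLRegime U c (-(n : ℤ)))
    (hhist : HistP klPredsV17F2 L M G P Q R β U μ 0 n)
    (hfr : FrameOK R U (nScales β) μ (klFlowFrameU L M β U μ n))
    (hE : EngineBoundsAtV17F2 L M G P Q β U μ n)
    (hJ : TwoLegReadJetBound L M cJ (klC4aJetC' P R) β U μ (klFlowFrameU L M β U μ n) n)
    {Zt Zs₁ Zs₂ : ℝ} (hUm : U ≤ klTwoLegMomU R Zt Zs₂) (hUq : U ≤ 1 / (64 * (|Zs₂| + 1)))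
    (hrow : Zs₁ * (c / Real.log 4 + U ^ 2) ≤ min (R.cz / 600) (1 / 10))
    (hGs : ∀ n' ≤ n, ∀ (L₁ M₁ : ℕ) [NeZero L₁] [NeZero M₁], L ≤ L₁ → Q.M0 β L₁ ≤ M₁ →
      (∀ j < n', histV17F2 L₁ M₁ G P Q R β U μ j ∧ TwoLegSlopes L₁ M₁ R β U μ (klFlowFrameU L₁ M₁ β U μ j) j) →
        TwoLegGridMomentsAtC L₁ M₁ Zt Zs₁ Zs₂ c β U μ (klFlowFrameU L₁ M₁ β U μ n') n')
    {d : ℝ} (hd : 0 ≤ d) (hdCL : d ≤ Q.CL β 0 / 4) {Dd Df Dc : ℕ → ℝ}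
    (hDsum : ∀ n' ≤ n, Dd n' + Df n' ≤ d * (4 : ℝ) ^ n' / 3) (hDc : ∀ n' ≤ n, Dc n' ≤ d * (4 : ℝ) ^ n' / 3)
    (hdualSp : ∀ n' ≤ n, ∀ (Mq : ℕ → ℕ) (L₁ L₂ M₂ : ℕ) [NeZero L₁] [NeZero L₂] [NeZero M₂], L ≤ L₁ → L₁ ∣ L₂ → Q.M0 β L₁ ≤ M₂ →
      Mq L₁ ≤ M₂ → Q.M0 β L₂ ≤ M₂ → Mq L₂ ≤ M₂ →
      (∀ j < n', histV17F2 L₁ M₂ G P Q R β U μ j ∧ TwoLegSlopes L₁ M₂ R β U μ (klFlowFrameU L₁ M₂ β U μ j) j) →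
      (∀ j < n', histV17F2 L₂ M₂ G P Q R β U μ j ∧ TwoLegSlopes L₂ M₂ R β U μ (klFlowFrameU L₂ M₂ β U μ j) j) →
      (∀ m < n', ∀ θ : ℝ, |klLocalPart L₁ M₂ β U μ (klFlowFrameU L₁ M₂ β U μ m) m θ -
        klLocalPart L₂ M₂ β U μ (klFlowFrameU L₂ M₂ β U μ m) m θ| ≤ d * (4 : ℝ) ^ m / L₁) →
      (∀ q : Fin 2 → ℝ, |(klFlowFrameU L₁ M₂ β U μ n').eval q - (klFlowFrameU L₂ M₂ β U μ n').eval q| ≤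
        (∑ m ∈ range n', d * (4 : ℝ) ^ m) / L₁) →
      ∃ (oc : SpaceTimeIdx L₁ M₂) (of : SpaceTimeIdx L₂ M₂),
        (∀ m ∈ ({omega0 M₂, (omega0 M₂).rev} : Finset (MatsubaraIdx M₂)), ∀ σ : Fin 2, imagTimeWeight β M₂ * ∑ ybar : TorusSite 2 L₁,
          (‖(∑ t₁ : ImagTimeIdx M₂,
              sectorisedKernel L₁ M₂ β (trivialMultiplier L₁ M₂)
                  (klEffectiveAction L₁ M₂ β U μ (klFlowFrameU L₁ M₂ β U μ n') klE0 n' - counterQuadratic L₁ M₂ β (klFlowFrameU L₁ M₂ β U μ n')) 2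
                  (![((0, σ), 0), ((0, σ), 1)] : Fin 2 → SectorLeg 1) ![oc, (t₁, oc.2 + ybar)] *
                Complex.exp (((matsubaraFreq β M₂ m * (imagTime β M₂ oc.1 - imagTime β M₂ t₁) : ℝ) : ℂ) * I)) -
            (∑ t₁ : ImagTimeIdx M₂,
              sectorisedKernel L₂ M₂ β (trivialMultiplier L₂ M₂)
                  (klEffectiveAction L₂ M₂ β U μ (klFlowFrameU L₂ M₂ β U μ n') klE0 n' - counterQuadratic L₂ M₂ β (klFlowFrameU L₂ M₂ β U μ n')) 2
                  (![((0, σ), 0), ((0, σ), 1)] : Fin 2 → SectorLeg 1) ![of, (t₁, of.2 + Torus.proj L₂ (Torus.cRep ybar))] *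
                Complex.exp (((matsubaraFreq β M₂ m * (imagTime β M₂ of.1 - imagTime β M₂ t₁) : ℝ) : ℂ) * I))‖ +
          ‖(∑ t₁ : ImagTimeIdx M₂,
              sectorisedKernel L₁ M₂ β (trivialMultiplier L₁ M₂)
                  (klEffectiveAction L₁ M₂ β U μ (klFlowFrameU L₁ M₂ β U μ n') klE0 n' - counterQuadratic L₁ M₂ β (klFlowFrameU L₁ M₂ β U μ n')) 2
                  (![((0, σ), 0), ((0, σ), 1)] : Fin 2 → SectorLeg 1) ![oc, (t₁, oc.2 + -ybar)] *
                Complex.exp (((matsubaraFreq β M₂ m * (imagTime β M₂ oc.1 - imagTime β M₂ t₁) : ℝ) : ℂ) * I)) -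
            (∑ t₁ : ImagTimeIdx M₂,
              sectorisedKernel L₂ M₂ β (trivialMultiplier L₂ M₂)
                  (klEffectiveAction L₂ M₂ β U μ (klFlowFrameU L₂ M₂ β U μ n') klE0 n' - counterQuadratic L₂ M₂ β (klFlowFrameU L₂ M₂ β U μ n')) 2
                  (![((0, σ), 0), ((0, σ), 1)] : Fin 2 → SectorLeg 1) ![of, (t₁, of.2 + -Torus.proj L₂ (Torus.cRep ybar))] *
                Complex.exp (((matsubaraFreq β M₂ m * (imagTime β M₂ of.1 - imagTime β M₂ t₁) : ℝ) : ℂ) * I))‖) ≤ Dd n' / L₁) ∧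
        (∀ m ∈ ({omega0 M₂, (omega0 M₂).rev} : Finset (MatsubaraIdx M₂)), ∀ σ : Fin 2, imagTimeWeight β M₂ *
          ∑ y ∈ univ.filter (fun y : TorusSite 2 L₂ => Torus.proj L₂ (Torus.cRep (fun i => (((y i).val : ℕ) : ZMod L₁))) ≠ y),
          (‖(∑ t₁ : ImagTimeIdx M₂,
              sectorisedKernel L₂ M₂ β (trivialMultiplier L₂ M₂)
                  (klEffectiveAction L₂ M₂ β U μ (klFlowFrameU L₂ M₂ β U μ n') klE0 n' - counterQuadratic L₂ M₂ β (klFlowFrameU L₂ M₂ β U μ n')) 2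
                  (![((0, σ), 0), ((0, σ), 1)] : Fin 2 → SectorLeg 1) ![of, (t₁, of.2 + y)] *
                Complex.exp (((matsubaraFreq β M₂ m * (imagTime β M₂ of.1 - imagTime β M₂ t₁) : ℝ) : ℂ) * I))‖ +
          ‖(∑ t₁ : ImagTimeIdx M₂,
              sectorisedKernel L₂ M₂ β (trivialMultiplier L₂ M₂)
                  (klEffectiveAction L₂ M₂ β U μ (klFlowFrameU L₂ M₂ β U μ n') klE0 n' - counterQuadratic L₂ M₂ β (klFlowFrameU L₂ M₂ β U μ n')) 2
                  (![((0, σ), 0), ((0, σ), 1)] : Fin 2 → SectorLeg 1) ![of, (t₁, of.2 + -y)] *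
                Complex.exp (((matsubaraFreq β M₂ m * (imagTime β M₂ of.1 - imagTime β M₂ t₁) : ℝ) : ℂ) * I))‖) ≤ Df n' / L₁))
    (hdualCut : ∀ n' ≤ n, ∀ (Mq : ℕ → ℕ) (L₁ M₁ M₂ : ℕ) [NeZero L₁] [NeZero M₁] [NeZero M₂], L ≤ L₁ → Q.M0 β L₁ ≤ M₁ → Mq L₁ ≤ M₁ →
      M₁ ≤ M₂ →
      (∀ j < n', histV17F2 L₁ M₁ G P Q R β U μ j ∧ TwoLegSlopes L₁ M₁ R β U μ (klFlowFrameU L₁ M₁ β U μ j) j) →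
      (∀ j < n', histV17F2 L₁ M₂ G P Q R β U μ j ∧ TwoLegSlopes L₁ M₂ R β U μ (klFlowFrameU L₁ M₂ β U μ j) j) →
      (∀ m < n', ∀ θ : ℝ, |klLocalPart L₁ M₁ β U μ (klFlowFrameU L₁ M₁ β U μ m) m θ -
        klLocalPart L₁ M₂ β U μ (klFlowFrameU L₁ M₂ β U μ m) m θ| ≤ d * (4 : ℝ) ^ m / L₁) →
      (∀ q : Fin 2 → ℝ, |(klFlowFrameU L₁ M₁ β U μ n').eval q - (klFlowFrameU L₁ M₂ β U μ n').eval q| ≤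
        (∑ m ∈ range n', d * (4 : ℝ) ^ m) / L₁) →
      ∃ (o₁ : SpaceTimeIdx L₁ M₁) (o₂ : SpaceTimeIdx L₁ M₂),
        (∀ σ : Fin 2, ∑ y : TorusSite 2 L₁,
          (‖(imagTimeWeight β M₁ : ℂ) * (∑ t₁ : ImagTimeIdx M₁,
              sectorisedKernel L₁ M₁ β (trivialMultiplier L₁ M₁)
                  (klEffectiveAction L₁ M₁ β U μ (klFlowFrameU L₁ M₁ β U μ n') klE0 n' - counterQuadratic L₁ M₁ β (klFlowFrameU L₁ M₁ β U μ n')) 2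
                  (![((0, σ), 0), ((0, σ), 1)] : Fin 2 → SectorLeg 1) ![o₁, (t₁, o₁.2 + y)] *
                Complex.exp (((matsubaraFreq β M₁ (omega0 M₁) * (imagTime β M₁ o₁.1 - imagTime β M₁ t₁) : ℝ) : ℂ) * I)) -
            (imagTimeWeight β M₂ : ℂ) * (∑ t₁ : ImagTimeIdx M₂,
              sectorisedKernel L₁ M₂ β (trivialMultiplier L₁ M₂)
                  (klEffectiveAction L₁ M₂ β U μ (klFlowFrameU L₁ M₂ β U μ n') klE0 n' - counterQuadratic L₁ M₂ β (klFlowFrameU L₁ M₂ β U μ n')) 2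
                  (![((0, σ), 0), ((0, σ), 1)] : Fin 2 → SectorLeg 1) ![o₂, (t₁, o₂.2 + y)] *
                Complex.exp (((matsubaraFreq β M₂ (omega0 M₂) * (imagTime β M₂ o₂.1 - imagTime β M₂ t₁) : ℝ) : ℂ) * I))‖ +
          ‖(imagTimeWeight β M₁ : ℂ) * (∑ t₁ : ImagTimeIdx M₁,
              sectorisedKernel L₁ M₁ β (trivialMultiplier L₁ M₁)
                  (klEffectiveAction L₁ M₁ β U μ (klFlowFrameU L₁ M₁ β U μ n') klE0 n' - counterQuadratic L₁ M₁ β (klFlowFrameU L₁ M₁ β U μ n')) 2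
                  (![((0, σ), 0), ((0, σ), 1)] : Fin 2 → SectorLeg 1) ![o₁, (t₁, o₁.2 + -y)] *
                Complex.exp (((matsubaraFreq β M₁ (omega0 M₁) * (imagTime β M₁ o₁.1 - imagTime β M₁ t₁) : ℝ) : ℂ) * I)) -
            (imagTimeWeight β M₂ : ℂ) * (∑ t₁ : ImagTimeIdx M₂,
              sectorisedKernel L₁ M₂ β (trivialMultiplier L₁ M₂)
                  (klEffectiveAction L₁ M₂ β U μ (klFlowFrameU L₁ M₂ β U μ n') klE0 n' - counterQuadratic L₁ M₂ β (klFlowFrameU L₁ M₂ β U μ n')) 2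
                  (![((0, σ), 0), ((0, σ), 1)] : Fin 2 → SectorLeg 1) ![o₂, (t₁, o₂.2 + -y)] *
                Complex.exp (((matsubaraFreq β M₂ (omega0 M₂) * (imagTime β M₂ o₂.1 - imagTime β M₂ t₁) : ℝ) : ℂ) * I))‖) ≤ Dc n' / L₁) ∧
        (∀ σ : Fin 2, ∑ y : TorusSite 2 L₁,
          (‖(imagTimeWeight β M₁ : ℂ) * (∑ t₁ : ImagTimeIdx M₁,
              sectorisedKernel L₁ M₁ β (trivialMultiplier L₁ M₁)
                  (klEffectiveAction L₁ M₁ β U μ (klFlowFrameU L₁ M₁ β U μ n') klE0 n' - counterQuadratic L₁ M₁ β (klFlowFrameU L₁ M₁ β U μ n')) 2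
                  (![((0, σ), 0), ((0, σ), 1)] : Fin 2 → SectorLeg 1) ![o₁, (t₁, o₁.2 + y)] *
                Complex.exp (((matsubaraFreq β M₁ (omega0 M₁).rev * (imagTime β M₁ o₁.1 - imagTime β M₁ t₁) : ℝ) : ℂ) * I)) -
            (imagTimeWeight β M₂ : ℂ) * (∑ t₁ : ImagTimeIdx M₂,
              sectorisedKernel L₁ M₂ β (trivialMultiplier L₁ M₂)
                  (klEffectiveAction L₁ M₂ β U μ (klFlowFrameU L₁ M₂ β U μ n') klE0 n' - counterQuadratic L₁ M₂ β (klFlowFrameU L₁ M₂ β U μ n')) 2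
                  (![((0, σ), 0), ((0, σ), 1)] : Fin 2 → SectorLeg 1) ![o₂, (t₁, o₂.2 + y)] *
                Complex.exp (((matsubaraFreq β M₂ (omega0 M₂).rev * (imagTime β M₂ o₂.1 - imagTime β M₂ t₁) : ℝ) : ℂ) * I))‖ +
          ‖(imagTimeWeight β M₁ : ℂ) * (∑ t₁ : ImagTimeIdx M₁,
              sectorisedKernel L₁ M₁ β (trivialMultiplier L₁ M₁)
                  (klEffectiveAction L₁ M₁ β U μ (klFlowFrameU L₁ M₁ β U μ n') klE0 n' - counterQuadratic L₁ M₁ β (klFlowFrameU L₁ M₁ β U μ n')) 2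
                  (![((0, σ), 0), ((0, σ), 1)] : Fin 2 → SectorLeg 1) ![o₁, (t₁, o₁.2 + -y)] *
                Complex.exp (((matsubaraFreq β M₁ (omega0 M₁).rev * (imagTime β M₁ o₁.1 - imagTime β M₁ t₁) : ℝ) : ℂ) * I)) -
            (imagTimeWeight β M₂ : ℂ) * (∑ t₁ : ImagTimeIdx M₂,
              sectorisedKernel L₁ M₂ β (trivialMultiplier L₁ M₂)
                  (klEffectiveAction L₁ M₂ β U μ (klFlowFrameU L₁ M₂ β U μ n') klE0 n' - counterQuadratic L₁ M₂ β (klFlowFrameU L₁ M₂ β U μ n')) 2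
                  (![((0, σ), 0), ((0, σ), 1)] : Fin 2 → SectorLeg 1) ![o₂, (t₁, o₂.2 + -y)] *
                Complex.exp (((matsubaraFreq β M₂ (omega0 M₂).rev * (imagTime β M₂ o₂.1 - imagTime β M₂ t₁) : ℝ) : ℂ) * I))‖) ≤ Dc n' / L₁)) :
    TwoLegStepV17F2 L M G P Q R β U μ n := by
  have _ := hP; have _ := hn1; have _ := hreg; have _ := hE
  have hRge : ∀ j, 0 ≤ R.Gfr j := hR.1.2.2
  have hcz : 0 < R.cz := hR.2.2
  have hcle : c ≤ klCurveC3 R := hc3.trans ((klEngC₃6_le_klEngC₃3 P R).trans (klEngC₃3_le_klCurveC3 P hRge))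
  have hc33 : c ≤ klEngC₃3 P R := hc3.trans (klEngC₃6_le_klEngC₃3 P R)
  have hU9 : U ≤ klEngU₀9 P R c := hUle.trans (klEngU₀10_le_klEngU₀9 P R c)
  have hU4 : U ≤ klEngU₀4 P R c := hUle.trans (klEngU₀10_le_klEngU₀4 P R c)
  have hU3 : U ≤ klEngU₀3 P R c := hU9.trans (klEngU₀9_le_klEngU₀3 P R c)
  have hUc : U ≤ klCurveU0 R := hU3.trans (klEngU₀3_le_klCurveU0 P hRge c)
  have hL3 : klEngL₃ β U ≤ L := klEngL₃_le_of_klEngL₄_le hL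
  have h0 : FrameOK R U (nScales β) μ 0 := klFrameOK_zeroC hR.1 U (nScales β) hμ
  have hβ0 : 0 < β := lt_of_lt_of_le (by norm_num [klBetaMin]) hβ
  have hU0 : U ≠ 0 := hU.ne'
  have hCL : ∀ n' ≤ n, Q.CL β 0 * (4 : ℝ) ^ n' ≤ Q.CL β n' := fun n' _ => le_of_eq (by
    rw [hQ.CL_eq, klEngQ7_CL_apply, klEngQ7_CL_apply]; ring)
  have hM0 : Q.M0 β L ≤ M := by rw [hQ.M0_eq]; exact hM
  have hQS : ∀ k, klC4aJetC' P R k ≤ Q.S' k := fun k => by rw [hQ.S'_eq]; exact klC4aJetC'_le_klEngQ7_S' P R k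
  have hQCL : 0 ≤ Q.CL β n := by rw [hQ.CL_eq]; exact klEngQ7_CL_nonneg P R β n
  have hrow600 : Zs₁ * (c / Real.log 4 + U ^ 2) ≤ R.cz / 600 := hrow.trans (min_le_left _ _)
  have hrow10 : Zs₁ * (c / Real.log 4 + U ^ 2) ≤ 1 / 10 := hrow.trans (min_le_right _ _)
  have hgridC : TwoLegGridFlowMomentsAtC L M Zt Zs₁ Zs₂ c β U μ n :=
    hGs n le_rfl L M le_rfl hM0 (fun j hj => ⟨histV17F2_of_histP hhist j hj, ((histP_klPredsV17F2_iff L M G P Q R β U μ 0 n).1 hhist j hj).2.2.2.2.1⟩)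
  have hgrid : TwoLegGridFlowMomentsAt L M Zt (Zs₁ * (c / Real.log 4 + U ^ 2) / |U| + Zs₂) β U μ n := hgridC.toFlowMomentsAt hU0
  obtain ⟨-, hZs0⟩ := hgrid.budget_nonneg hβ0 hU0
  have hsmall := twoLeg_gridLegSmallnessC_of_generic_doors (c := c) (Zs₁ := Zs₁) (Zs₂ := Zs₂) (hRge 0) (hRge 1) hU hUq hUc hrow10
  have hsp := spLeg_allScales_of_gridMoments_V17F2_geometric4 (G := G) (P := P) hRge hc hcle hU hUc hβ hβc hμ hL3 h0 hn hd hdCL hCL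
    hZs0 hsmall hDsum (fun n'' hn'' Mq L₁ L₂ M₂ _ _ _ hLL₁ _ hM₁ _ _ _ hh₁ _ _ _ => (hGs n'' hn'' L₁ M₂ hLL₁ hM₁ hh₁).toMomentsAt hU0) hdualSp n le_rfl
  have hcut := cutLeg_allScales_of_gridMoments_V17F2_geometric4 (G := G) (P := P) hRge hc hcle hU hUc hβ hβc hμ hL3 h0 hn hd hdCL hCL
    hZs0 hsmall hDc (fun n'' hn'' Mq L₁ M₁ M₂ _ _ _ hLL₁ hM₁ _ _ hh₁ _ _ _ => (hGs n'' hn'' L₁ M₁ hLL₁ hM₁ hh₁).toMomentsAt hU0) hdualCut n le_rfl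
  obtain ⟨hzt, hms⟩ := twoLeg_slopeSizes_of_twoLegGridMomentsAtC hβ0 hU0 ((twoLegGridFlowMomentsAtC_iff Zt Zs₁ Zs₂ c β U μ n).1 hgridC)
  obtain ⟨hfitT, hfit1⟩ := mixed_fits_of_le_klTwoLegMomU (c := c) (Zs₁ := Zs₁) hcz hU hUm hrow600
  have hz : ∀ k ∈ klShell L μ (klFlowFrameU L M β U μ n) n,
      |klFieldStrength L M β U μ (klFlowFrameU L M β U μ n) n k - 1| ≤ R.cz * |U| := fun k _ => (hzt k).trans hfitT
  exact twoLegStepV17F2_of_jets_sepTubeGradient_nestedLegs_pkg G Q P hR hc hc33 hμ hU hU4 hβ hβc hL3 hn hfr hQCL hGS hQS hJ.1 hJ.2 hz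
    (fun q _ => hms q) hfit1 hcut hsp

end Summit.HubbardSuperconductivity.HubbardSuperconductivity.Theorems.EngineV8

end
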